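import Literature.MathematicalPhysics.StatisticalMechanics.OneCrossingMixture

/-!
# Proof of the one-crossing transport lemma — crux-ideate 11779, ideator 2

`oneCrossingTransport`: if `g ≥ 0` on `(0,∞)` and `w ≤ 0` on `(0,t₀)`, `w ≥ 0` on `[t₀,∞)`, then
`s ↦ e^{t₀ s} ∫_0^∞ g(t) w(t) e^{-ts} dt` is non-increasing on `(0, ∞)` — no differentiation: for `0 < a ≤ b`
the integrand of the difference, `g w · (e^{(t₀-t)b} − e^{(t₀-t)a})`, is `≤ 0` pointwise (the two factors have
opposite signs on both sides of `t₀`). Consequence: the transform changes sign at most once, `+` then `−`.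
-/

namespace Summit.AtomisticToContinuum.Crystallization.Cruxes.PeriodicGivenLayered.IdeatorTwo

open MeasureTheory Set Real

/-- Verbatim `Sketch.OneCrossingTransport` (integrability asked of the transform's integrand only). -/
def OneCrossingTransport' : Prop :=
  ∀ (g w : ℝ → ℝ) (t₀ : ℝ), 0 < t₀ → (∀ t, 0 < t → 0 ≤ g t) → (∀ t ∈ Set.Ioo 0 t₀, w t ≤ 0) →
    (∀ t, t₀ ≤ t → 0 ≤ w t) →
    (∀ s : ℝ, 0 < s → IntegrableOn (fun t => g t * w t * Real.exp (-(t * s))) (Set.Ioi 0)) →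
    AntitoneOn (fun s : ℝ => Real.exp (t₀ * s) * ∫ t in Set.Ioi 0, g t * w t * Real.exp (-(t * s)))
      (Set.Ioi 0)

theorem oneCrossingTransport : OneCrossingTransport' := by
  intro g w t₀ ht₀ hg hwneg hwpos hint a ha b hb hab
  simp only [Set.mem_Ioi] at ha hb
  -- the difference f b - f a as one integral
  have hIa := hint a ha
  have hIb := hint b hb
  have key : Real.exp (t₀ * b) * (∫ t in Set.Ioi 0, g t * w t * Real.exp (-(t * b)))
      - Real.exp (t₀ * a) * (∫ t in Set.Ioi 0, g t * w t * Real.exp (-(t * a)))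
      = ∫ t in Set.Ioi 0, (Real.exp (t₀ * b) * (g t * w t * Real.exp (-(t * b)))
          - Real.exp (t₀ * a) * (g t * w t * Real.exp (-(t * a)))) := by
    rw [integral_sub (hIb.const_mul _) (hIa.const_mul _), integral_const_mul, integral_const_mul]
  have hle : (∫ t in Set.Ioi 0, (Real.exp (t₀ * b) * (g t * w t * Real.exp (-(t * b)))
          - Real.exp (t₀ * a) * (g t * w t * Real.exp (-(t * a))))) ≤ 0 := by
    refine setIntegral_nonpos measurableSet_Ioi fun t ht => ?_
    simp only [Set.mem_Ioi] at ht
    have e1 : Real.exp (t₀ * b) * (g t * w t * Real.exp (-(t * b)))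
        - Real.exp (t₀ * a) * (g t * w t * Real.exp (-(t * a)))
        = (g t * w t) * (Real.exp ((t₀ - t) * b) - Real.exp ((t₀ - t) * a)) := by
      have hb' : Real.exp ((t₀ - t) * b) = Real.exp (t₀ * b) * Real.exp (-(t * b)) := by
        rw [← Real.exp_add]; ring_nf
      have ha' : Real.exp ((t₀ - t) * a) = Real.exp (t₀ * a) * Real.exp (-(t * a)) := by
        rw [← Real.exp_add]; ring_nf
      rw [hb', ha']; ring
    rw [e1]
    rcases le_or_gt t₀ t with hcase | hcase
    · -- t ≥ t₀ : g w ≥ 0 and the exponential difference ≤ 0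
      have h1 : 0 ≤ g t * w t := mul_nonneg (hg t ht) (hwpos t hcase)
      have h2 : Real.exp ((t₀ - t) * b) - Real.exp ((t₀ - t) * a) ≤ 0 := by
        have : (t₀ - t) * b ≤ (t₀ - t) * a := by nlinarith
        linarith [Real.exp_le_exp.2 this]
      exact mul_nonpos_of_nonneg_of_nonpos h1 h2
    · -- t < t₀ : g w ≤ 0 and the exponential difference ≥ 0
      have h1 : g t * w t ≤ 0 := mul_nonpos_of_nonneg_of_nonpos (hg t ht) (hwneg t ⟨ht, hcase⟩)
      have h2 : 0 ≤ Real.exp ((t₀ - t) * b) - Real.exp ((t₀ - t) * a) := by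
        have : (t₀ - t) * a ≤ (t₀ - t) * b := by nlinarith
        linarith [Real.exp_le_exp.2 this]
      exact mul_nonpos_of_nonpos_of_nonneg h1 h2
  -- conclude
  show Real.exp (t₀ * b) * (∫ t in Set.Ioi 0, g t * w t * Real.exp (-(t * b)))
      ≤ Real.exp (t₀ * a) * (∫ t in Set.Ioi 0, g t * w t * Real.exp (-(t * a)))
  linarith [key ▸ hle]

/-- Corollary (the shape used twice by `RegistrySignAntitone`): once the transform is `≤ 0` at some
`s₁ > 0` it stays `≤ 0` for all `s ≥ s₁`. -/
theorem nonpos_of_nonpos_of_le {g w : ℝ → ℝ} {t₀ : ℝ} (ht₀ : 0 < t₀) (hg : ∀ t, 0 < t → 0 ≤ g t)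
    (hwneg : ∀ t ∈ Set.Ioo 0 t₀, w t ≤ 0) (hwpos : ∀ t, t₀ ≤ t → 0 ≤ w t)
    (hint : ∀ s : ℝ, 0 < s → IntegrableOn (fun t => g t * w t * Real.exp (-(t * s))) (Set.Ioi 0))
    {s₁ s : ℝ} (hs₁ : 0 < s₁) (hs : s₁ ≤ s)
    (h₁ : (∫ t in Set.Ioi 0, g t * w t * Real.exp (-(t * s₁))) ≤ 0) :
    (∫ t in Set.Ioi 0, g t * w t * Real.exp (-(t * s))) ≤ 0 := by
  have hmono := oneCrossingTransport g w t₀ ht₀ hg hwneg hwpos hint (Set.mem_Ioi.2 hs₁)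
    (Set.mem_Ioi.2 (lt_of_lt_of_le hs₁ hs)) hs
  -- hmono : exp(t₀ s) * F s ≤ exp(t₀ s₁) * F s₁ ≤ 0
  have h2 : Real.exp (t₀ * s₁) * (∫ t in Set.Ioi 0, g t * w t * Real.exp (-(t * s₁))) ≤ 0 :=
    mul_nonpos_of_nonneg_of_nonpos (Real.exp_pos _).le h₁
  have h3 : Real.exp (t₀ * s) * (∫ t in Set.Ioi 0, g t * w t * Real.exp (-(t * s))) ≤ 0 :=
    hmono.trans h2
  rcases le_or_gt (∫ t in Set.Ioi 0, g t * w t * Real.exp (-(t * s))) 0 with h | hcon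
  · exact h
  · have : 0 < Real.exp (t₀ * s) * (∫ t in Set.Ioi 0, g t * w t * Real.exp (-(t * s))) :=
      mul_pos (Real.exp_pos _) hcon
    linarith

end Summit.AtomisticToContinuum.Crystallization.Cruxes.PeriodicGivenLayered.IdeatorTwo
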